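import Mathlib
import Summits.Ventures.HodgeRepro2.T5InertSphericalSubquotientCompletion
import Summits.Ventures.HodgeRepro2.T5RecordSatakeCell
import Summits.Ventures.HodgeRepro2.T5HeckeConjugationTransport

/-!
# THE UNRAMIFIED SPECTRUM OF THE RECORD'S OWN PAIR: EVERY `K_v`-SPHERICAL IRREDUCIBLE OF `U(1 ⊗ H)` IS A SPHERICAL
SUBQUOTIENT OF AN UNRAMIFIED PRINCIPAL SERIES

Tier-5 support N3 / §G-N4.2 (seat p3, gen 85). Files 333–340 classified the `K`-spherical irreducible
representations of the abstract inert package `U(J₃(u))` and realised each as the spherical subquotient of an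
unramified principal series `I(α q⁻²)`. This file carries the statement to THE RECORD'S OWN PAIR
`(U(1 ⊗ H), K_v)` (files 231 / 241 / 243: `U(1 ⊗ H) ≃* U(H_w) ≃* U(J₃(u₀))` by `recordNonSplitEquiv'` and the
integral change of basis `P` with `Pᴴ H_w P = J₃(u₀)`, the hyperspecial subgroups matched) — rows 12–14's
«principal-series identification» on the record's pair, the item «rows 12–14 transport» of the still-print list:

* generic transport along a group isomorphism `φ : G ≃* G'` (`comp φ σ := σ ∘ φ`): **`isIrreducible_comp_iff`**
  (subrepresentations correspond, `subrepEquiv`), **`invariants_comp`** (the `K`-invariants are the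
  `K'`-invariants), **`kFinite_comp_iff`** (stabilisers correspond, indices agree), `equivComp` /
  **`equivCompSymm`** (isomorphisms transport);
* **`exists_param_nonempty_equiv_inertSphericalQuot`** — on the abstract package: EVERY irreducible `K`-finite `ρ`
  with non-zero finite-dimensional `K`-invariants is `≅ inertSphericalQuot (α q⁻²)` for some `α ≠ 0` (files 334 /
  337); **`…_adicCompletion`** — the same on Mathlib's completions with `q = N(v)`;
* **`exists_mulEquiv_forall_nonempty_equiv_inertSphericalQuot_record`** — THE RECORD: at an inert good place, there
  are `u₀ ∈ 𝒪_{K⁺_v}ˣ` and `Φ : U(J₃(u₀)) ≃* U(1 ⊗ H)` matching the hyperspecial subgroups such that every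
  irreducible `K_v`-finite representation of `U(1 ⊗ H)` with non-zero finite-dimensional `K_v`-invariants is
  `≅ (inertSphericalQuot (α N(v)⁻²)) ∘ Φ⁻¹` for some `α ≠ 0` — every `K_v`-spherical irreducible of the record's
  pair is the spherical subquotient of an unramified principal series, transported along `Φ`.

Nothing here is a statement about (P), theta lifts or L-values. §8(d): uses an L-value-free non-vanishing
device: NO.
-/

open Matrix NumberField NumberField.IsCMField IsDedekindDomain IsDedekindDomain.HeightOneSpectrum Module
  MulAction
open scoped TensorProduct Pointwise
open Summit.Ventures.HodgeRepro2.T5UnitaryGroupForm Summit.Ventures.HodgeRepro2.T5UnitaryHeckeAdjoint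
  Summit.Ventures.HodgeRepro2.T5HeckePermutationModule Summit.Ventures.HodgeRepro2.LevelPositivity
  Summit.Ventures.HodgeRepro2.T5LevelIdempotent Summit.Ventures.HodgeRepro2.T5StarOfInvolution
  Summit.Ventures.HodgeRepro2.T5FinitePlaceCM Summit.Ventures.HodgeRepro2.T5NonSplitPlaceUnitaryGroup
  Summit.Ventures.HodgeRepro2.T5RecordHyperspecial Summit.Ventures.HodgeRepro2.T5GlobalLatticeAlmostAll
  Summit.Ventures.HodgeRepro2.T5HermitianThreeElements Summit.Ventures.HodgeRepro2.T5GaloisCartanThree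
  Summit.Ventures.HodgeRepro2.T5InertDegreeGalois Summit.Ventures.HodgeRepro2.T5InertPlaceCompletion
  Summit.Ventures.HodgeRepro2.T5InertDegreeAdicCompletion Summit.Ventures.HodgeRepro2.T5InertSatakeTransform
  Summit.Ventures.HodgeRepro2.T5InertSatakeTransformCompletion Summit.Ventures.HodgeRepro2.T5InertUnipotentResidue
  Summit.Ventures.HodgeRepro2.T5HeckeBasisCells Summit.Ventures.HodgeRepro2.T5HeckeDoubleCoset
  Summit.Ventures.HodgeRepro2.T5InertHeckeCharacter Summit.Ventures.HodgeRepro2.T5HeckeCommutativeMultiplicityOne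
  Summit.Ventures.HodgeRepro2.T5HeckeInducedIrreducible Summit.Ventures.HodgeRepro2.T5HeckeCharacterRepresentation
  Summit.Ventures.HodgeRepro2.T5InertSphericalClassification Summit.Ventures.HodgeRepro2.T5InertSphericalVector
  Summit.Ventures.HodgeRepro2.T5InertSphericalSubquotient
  Summit.Ventures.HodgeRepro2.T5InertSphericalSubquotientCompletion
  Summit.Ventures.HodgeRepro2.T5HeckeConjugationTransport Summit.Ventures.HodgeRepro2.T5RecordSatakeCell
  Summit.Ventures.HodgeRepro2.T5SplitPlaceUnitaryGroup Summit.Ventures.HodgeRepro2.T5FinitePlaceNormIndex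
  Summit.Ventures.HodgeRepro2.T5HermitianLocalIsotropyN3 Summit.Ventures.HodgeRepro2.T5FinitePlaceSplitClassification
  Summit.Ventures.HodgeRepro2.T5InertDegreeCompletion Summit.Ventures.HodgeRepro2.T5InertPlaceCompletionCells
  Summit.Ventures.HodgeRepro2.T5InertTopCoefficient Summit.Ventures.HodgeRepro2.T5SplitUnitaryGroupEquiv
  Summit.Ventures.HodgeRepro2.T5InertHeckeCells Summit.Ventures.HodgeRepro2.T5HeckeGeneratorTransport
  Summit.Ventures.HodgeRepro2.T5RecordSatake Summit.Ventures.HodgeRepro2.T5CartanCellsDistinct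
  Summit.Ventures.HodgeRepro2.T5HeckeIsomorphismTransport Summit.Ventures.HodgeRepro2.T5HeckeIsomorphismTransportCells

namespace Summit.Ventures.HodgeRepro2.T5RecordSphericalSpectrum

/-! ## Transport of representations along a group isomorphism -/

section Transport

variable {G G' : Type*} [Group G] [Group G'] {k : Type*} [Field k] {V : Type*} [AddCommGroup V] [Module k V]
  (φ : G ≃* G') (σ : Representation k G' V)

/-- **The pull-back `σ ∘ φ`** of a representation of `G'` along `φ : G ≃* G'`. -/
abbrev comp : Representation k G V := σ.comp φ.toMonoidHom

/-- `(σ ∘ φ) g = σ (φ g)`. -/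
theorem comp_apply (g : G) : comp φ σ g = σ (φ g) := rfl

/-- **Subrepresentations of `σ ∘ φ` are the subrepresentations of `σ`** (the same submodules). -/
def subrepEquiv : Subrepresentation (comp φ σ) ≃o Subrepresentation σ where
  toFun S := ⟨S.toSubmodule, fun g' _ hv => by
    have h := S.apply_mem_toSubmodule (φ.symm g') hv
    rwa [comp_apply, MulEquiv.apply_symm_apply] at h⟩
  invFun T := ⟨T.toSubmodule, fun g _ hv => T.apply_mem_toSubmodule (φ g) hv⟩
  left_inv S := Subrepresentation.toSubmodule_injective rfl
  right_inv T := Subrepresentation.toSubmodule_injective rfl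
  map_rel_iff' := Iff.rfl

/-- **Irreducibility transports** along a group isomorphism. -/
theorem isIrreducible_comp_iff : (comp φ σ).IsIrreducible ↔ σ.IsIrreducible :=
  OrderIso.isSimpleOrder_iff (subrepEquiv φ σ)

variable {K : Subgroup G} {K' : Subgroup G'} (hK : ∀ g : G, g ∈ K ↔ φ g ∈ K')

include hK in
/-- **The `K`-invariants of `σ ∘ φ` are the `K'`-invariants of `σ`** when `φ` matches `K` with `K'`. -/
theorem invariants_comp : invariants (comp φ σ) K = invariants σ K' := by
  ext v
  rw [mem_invariants_iff, mem_invariants_iff]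
  constructor
  · intro h g' hg'
    have := h (φ.symm g') ((hK _).2 (by rwa [MulEquiv.apply_symm_apply]))
    rwa [comp_apply, MulEquiv.apply_symm_apply] at this
  · intro h g hg
    exact h (φ g) ((hK g).1 hg)

include hK in
/-- `φ` restricted to `K` is an isomorphism `K ≃* K'`. -/
noncomputable def subgroupEquiv : K ≃* K' where
  toFun κ := ⟨φ κ, (hK κ).1 κ.2⟩
  invFun κ' := ⟨φ.symm κ', (hK _).2 (by rw [MulEquiv.apply_symm_apply]; exact κ'.2)⟩
  left_inv κ := Subtype.ext (φ.symm_apply_apply κ)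
  right_inv κ' := Subtype.ext (φ.apply_symm_apply κ')
  map_mul' κ₁ κ₂ := Subtype.ext (map_mul φ _ _)

/-- The stabiliser in `K` of `v` for `σ ∘ φ` is the pull-back of the stabiliser in `K'` for `σ`. -/
theorem stabilizerIn_comp (v : V) :
    stabilizerIn (comp φ σ) K v = (stabilizerIn σ K' v).comap (subgroupEquiv φ hK).toMonoidHom := by
  ext κ
  rw [Subgroup.mem_comap, mem_stabilizerIn_iff, mem_stabilizerIn_iff]
  rfl

include hK in
/-- **`K`-finiteness transports**: `σ ∘ φ` is `K`-finite iff `σ` is `K'`-finite (the indices of the stabilisers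
agree under the isomorphism `K ≃* K'`). -/
theorem kFinite_comp_iff : KFinite (comp φ σ) K ↔ KFinite σ K' := by
  have hidx : ∀ v : V, (stabilizerIn (comp φ σ) K v).index = (stabilizerIn σ K' v).index := fun v => by
    rw [stabilizerIn_comp φ σ hK v]
    exact Subgroup.index_comap_of_surjective _ (subgroupEquiv φ hK).surjective
  constructor
  · intro h v
    haveI := h v
    exact ⟨by rw [← hidx v]; exact Subgroup.FiniteIndex.index_ne_zero⟩
  · intro h v
    haveI := h v
    exact ⟨by rw [hidx v]; exact Subgroup.FiniteIndex.index_ne_zero⟩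

variable {W : Type*} [AddCommGroup W] [Module k W] (τ : Representation k G' W)

/-- **Isomorphisms transport**: `σ ≅ τ` gives `σ ∘ φ ≅ τ ∘ φ`. -/
def equivComp (e : σ.Equiv τ) : (comp φ σ).Equiv (comp φ τ) :=
  Representation.Equiv.mk e.toLinearEquiv fun g => e.isIntertwining' (φ g)

/-- **Isomorphisms transport back**: `σ ∘ φ ≅ τ'` gives `σ ≅ τ' ∘ φ⁻¹`. -/
def equivCompSymm {W : Type*} [AddCommGroup W] [Module k W] {τ' : Representation k G W}
    (e : (comp φ σ).Equiv τ') : σ.Equiv (comp φ.symm τ') :=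
  Representation.Equiv.mk e.toLinearEquiv fun g' => by
    have h := e.isIntertwining' (φ.symm g')
    rwa [comp_apply, MulEquiv.apply_symm_apply] at h

end Transport

/-! ## The abstract package: every spherical irreducible is a spherical subquotient -/

section Abstract

universe uR uE uk

variable {R : Type uR} {E : Type uE} [CommRing R] [Field E] [StarRing E] [Algebra R E] [IsFractionRing R E]
  [IsDomain R] [IsDiscreteValuationRing R] [Finite (IsLocalRing.ResidueField R)]
  (hstar : ∀ x : E, IsLocalization.IsInteger R x → IsLocalization.IsInteger R (star x))
  (u : E) (hsu : star u = u) (hu0 : u ≠ 0) (hu : IsLocalization.IsInteger R u)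
  (hu' : IsLocalization.IsInteger R u⁻¹) {ϖ : R} (hϖ : Irreducible ϖ)
  (hs : star (algebraMap R E ϖ) = algebraMap R E ϖ) (k : Type uk) [Field k] [CharZero k] [IsAlgClosed k]
  (he : ∃ e : R, algebraMap R E e + star (algebraMap R E e) = 1)
  (hnt : ∃ t, T5InertResidueInvolution.residueStar hstar hϖ hs t ≠ t)

include he hnt in
/-- **EVERY `K`-SPHERICAL IRREDUCIBLE REPRESENTATION OF `U(J₃(u))` IS A SPHERICAL SUBQUOTIENT OF AN UNRAMIFIED
PRINCIPAL SERIES**: for `ρ` irreducible, `K`-finite, with non-zero finite-dimensional `K`-invariants, some `α ≠ 0`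
has `ρ ≅ inertSphericalQuot (α q⁻²)` (`λ := χ_ρ(T₁)`; file 334's uniqueness, file 337's realisation). -/
theorem exists_param_nonempty_equiv_inertSphericalQuot {V : Type*} [AddCommGroup V] [Module k V]
    (ρ : Representation k (formUnitaryGroup (J3 u)) V) [ρ.IsIrreducible]
    (hK : KFinite ρ (hyperspecialSubgroup R (J3 u)))
    [FiniteDimensional k (invariants ρ (hyperspecialSubgroup R (J3 u)))]
    (hne : invariants ρ (hyperspecialSubgroup R (J3 u)) ≠ ⊥) :
    ∃ α : k, α ≠ 0 ∧ Nonempty (ρ.Equiv (inertSphericalQuot hstar u hsu hu0 hu hu' hϖ hs k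
      (α * ((Nat.card (traceZero R E) : k) ^ 2)⁻¹))) := by
  set lam := heckeCharacter ρ hK (fun _ => inferInstance) hne (mul_comm' hstar u hsu hu0 hu hu' hϖ hs k)
    (heckeBasisCells hstar u hsu hu0 hu hu' hϖ hs k 1) with hlamdef
  obtain ⟨χ, hχ⟩ := exists_algHom_apply_one_eq hstar u hsu hu0 hu hu' hϖ hs k lam
  obtain ⟨α, hα, hlam⟩ := exists_param_eq ((Nat.card (traceZero R E) : ℕ) : k)
    (natCast_card_traceZero_ne_zero (R := R) (E := E) k) lam
  letI := charModule k (hyperspecialSubgroup R (J3 u)) χ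
  letI := charScalarTower k (hyperspecialSubgroup R (J3 u)) χ
  haveI := isIrreducible_quotRep_char k (hyperspecialSubgroup R (J3 u)) (fun _ => inferInstance) χ
  haveI := finiteDimensional_invariants_quotRep_char k (hyperspecialSubgroup R (J3 u)) (fun _ => inferInstance) χ
  obtain ⟨e₁⟩ := (nonempty_equiv_quotRep_char_iff hstar u hsu hu0 hu hu' hϖ hs k lam χ hχ ρ hK hne).2 rfl
  obtain ⟨e₂⟩ := nonempty_equiv_inertSphericalQuot_quotRep hstar u hsu hu0 hu hu' hϖ hs k he hnt hα χ
    (hχ.trans hlam)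
  exact ⟨α, hα, ⟨e₁.trans e₂.symm⟩⟩

include he hnt in
/-- The same with `q` replaced by any `q'` equal to it (the form that transports to the completions, `q' = N(v)`). -/
theorem exists_param_nonempty_equiv_inertSphericalQuot_of_eq (q' : k) (hq' : (Nat.card (traceZero R E) : k) = q')
    {V : Type*} [AddCommGroup V] [Module k V]
    (ρ : Representation k (formUnitaryGroup (J3 u)) V) [ρ.IsIrreducible]
    (hK : KFinite ρ (hyperspecialSubgroup R (J3 u)))
    [FiniteDimensional k (invariants ρ (hyperspecialSubgroup R (J3 u)))]
    (hne : invariants ρ (hyperspecialSubgroup R (J3 u)) ≠ ⊥) :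
    ∃ α : k, α ≠ 0 ∧ Nonempty (ρ.Equiv (inertSphericalQuot hstar u hsu hu0 hu hu' hϖ hs k (α * (q' ^ 2)⁻¹))) := by
  subst hq'
  exact exists_param_nonempty_equiv_inertSphericalQuot hstar u hsu hu0 hu hu' hϖ hs k he hnt ρ hK hne

include he hnt in
/-- `exists_param_nonempty_equiv_inertSphericalQuot_of_eq` with the finite-dimensionality of the `K`-invariants as
an explicit hypothesis (for applications where instance synthesis is expensive). -/
theorem exists_param_nonempty_equiv_inertSphericalQuot_of_eq' (q' : k)
    (hq' : (Nat.card (traceZero R E) : k) = q') {V : Type*} [AddCommGroup V] [Module k V]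
    (ρ : Representation k (formUnitaryGroup (J3 u)) V) (hirr : ρ.IsIrreducible)
    (hK : KFinite ρ (hyperspecialSubgroup R (J3 u)))
    (hfd : FiniteDimensional k (invariants ρ (hyperspecialSubgroup R (J3 u))))
    (hne : invariants ρ (hyperspecialSubgroup R (J3 u)) ≠ ⊥) :
    ∃ α : k, α ≠ 0 ∧ Nonempty (ρ.Equiv (inertSphericalQuot hstar u hsu hu0 hu hu' hϖ hs k (α * (q' ^ 2)⁻¹))) := by
  haveI := hirr
  haveI := hfd
  exact exists_param_nonempty_equiv_inertSphericalQuot_of_eq hstar u hsu hu0 hu hu' hϖ hs k he hnt q' hq' ρ hK hne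

end Abstract

/-! ## The record's own pair -/

section Record

variable (K : Type*) [Field K] [NumberField K] [IsCMField K]
variable (v : HeightOneSpectrum (𝓞 (maximalRealSubfield K))) (w : HeightOneSpectrum (𝓞 K))
  [w.asIdeal.LiesOver v.asIdeal]
  [IsDiscreteValuationRing (integralClosure (v.adicCompletionIntegers (maximalRealSubfield K)) (w.adicCompletion K))]
  [Finite (IsLocalRing.ResidueField (integralClosure (v.adicCompletionIntegers (maximalRealSubfield K))
    (w.adicCompletion K)))]
  [IsFractionRing (integralClosure (v.adicCompletionIntegers (maximalRealSubfield K)) (w.adicCompletion K))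
    (w.adicCompletion K)]
variable {θ : maximalRealSubfield K} {y : K}
  (hθ : algebraMap (maximalRealSubfield K) K θ = y ^ 2) (hy : complexConj K y ≠ y)
  (hsq : ¬ IsSquare (algebraMap (maximalRealSubfield K) (v.adicCompletion (maximalRealSubfield K)) θ))
  (he : v.asIdeal.ramificationIdx' w.asIdeal = 1)
  {ϖ : v.adicCompletionIntegers (maximalRealSubfield K)} (hϖ : Irreducible ϖ)
  (hinert : Irreducible (algebraMap (v.adicCompletionIntegers (maximalRealSubfield K)) (w.adicCompletionIntegers K) ϖ))
variable {r : ℕ} (l : Fin r → 𝓞 K) (k : Type*) [Field k] [CharZero k] [IsAlgClosed k]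

section MatchedIsomorphism

variable [StarRing (w.adicCompletion K)]
  (hst : ∀ x : w.adicCompletion K, star x = localConj v w hθ.symm (span_pair_eq_top K hy) hsq (complexConj K) x)

include hθ hy hsq he hϖ hinert hst in
/-- **THE UNRAMIFIED SPECTRUM OF THE RECORD'S OWN PAIR, GIVEN THE MATCHING ISOMORPHISM**: for `u₀ ∈ 𝒪_{K⁺_v}ˣ` and
`Φ : U(J₃(u₀)) ≃* U(1 ⊗ H)` matching the hyperspecial subgroups (the star on `K_w` being the local conjugation),
every irreducible `K_v`-finite representation `ρ` of `U(1 ⊗ H)` with non-zero finite-dimensional `K_v`-invariants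
is `≅ (inertSphericalQuot (α N(v)⁻²)) ∘ Φ⁻¹` for some `α ≠ 0` (the transport lemmas above +
`exists_param_nonempty_equiv_inertSphericalQuot_of_eq`). -/
theorem forall_nonempty_equiv_inertSphericalQuot_record_of_mulEquiv {H : Matrix (Fin 3) (Fin 3) K}
    (u₀ : (v.adicCompletionIntegers (maximalRealSubfield K))ˣ)
    (Φ : letI := tensorStarRing K v
      ↥(formUnitaryGroup (J3 (algebraMap (v.adicCompletionIntegers (maximalRealSubfield K))
        (w.adicCompletion K) (u₀ : v.adicCompletionIntegers (maximalRealSubfield K))))) ≃*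
        ↥(formUnitaryGroup (tensorGram K v H)))
    (hmatch : letI := tensorStarRing K v
      ∀ g, g ∈ hyperspecialSubgroup
          (integralClosure (v.adicCompletionIntegers (maximalRealSubfield K)) (w.adicCompletion K))
          (J3 (algebraMap (v.adicCompletionIntegers (maximalRealSubfield K)) (w.adicCompletion K)
            (u₀ : v.adicCompletionIntegers (maximalRealSubfield K)))) ↔ Φ g ∈ recordHyperspecial K v l H)
    {V : Type*} [AddCommGroup V] [Module k V]
    (ρ : letI := tensorStarRing K v
      Representation k (↥(formUnitaryGroup (tensorGram K v H))) V) [ρ.IsIrreducible]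
    (hK : KFinite ρ (recordHyperspecial K v l H))
    [FiniteDimensional k (invariants ρ (recordHyperspecial K v l H))]
    (hne : invariants ρ (recordHyperspecial K v l H) ≠ ⊥) :
    letI := tensorStarRing K v
    ∃ α : k, α ≠ 0 ∧ Nonempty (ρ.Equiv (comp Φ.symm
      (inertSphericalQuot (hstar_of_star_eq (localConj v w hθ.symm (span_pair_eq_top K hy) hsq (complexConj K)) hst)
            (algebraMap (v.adicCompletionIntegers (maximalRealSubfield K)) (w.adicCompletion K)
              (u₀ : v.adicCompletionIntegers (maximalRealSubfield K)))
            (star_algebraMap_of_star_eq (localConj v w hθ.symm (span_pair_eq_top K hy) hsq (complexConj K)) hst (u₀ : v.adicCompletionIntegers (maximalRealSubfield K)))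
            (algebraMap_unit_ne_zero (F := v.adicCompletion (maximalRealSubfield K)) u₀)
            (isInteger_algebraMap (u₀ : v.adicCompletionIntegers (maximalRealSubfield K)))
            (isInteger_algebraMap_unit_inv u₀)
            (irreducible_uniformiser (map_maximalIdeal_integralClosure_eq_of_irreducible v w hϖ hinert) hϖ)
            (star_algebraMap_of_star_eq (localConj v w hθ.symm (span_pair_eq_top K hy) hsq (complexConj K)) hst ϖ) k
        (α * ((Ideal.absNorm v.asIdeal : k) ^ 2)⁻¹)))) := by
  letI := tensorStarRing K v
  have hσ : (localConj v w hθ.symm (span_pair_eq_top K hy) hsq (complexConj K)) ≠ 1 := localConj_ne_one v w hθ.symm (span_pair_eq_top K hy) hsq (complexConj K)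
    (complexConj_apply_eq_neg K hθ hy)
  have h2 := finrank_eq_two K v w hθ hy hsq
  have hirr : (comp Φ ρ).IsIrreducible := (isIrreducible_comp_iff Φ ρ).2 inferInstance
  have hK' : KFinite (comp Φ ρ) (hyperspecialSubgroup
          (integralClosure (v.adicCompletionIntegers (maximalRealSubfield K)) (w.adicCompletion K))
          (J3 (algebraMap (v.adicCompletionIntegers (maximalRealSubfield K)) (w.adicCompletion K)
            (u₀ : v.adicCompletionIntegers (maximalRealSubfield K))))) := (kFinite_comp_iff Φ ρ hmatch).2 hK
  have hinv := invariants_comp Φ ρ hmatch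
  have hfd : FiniteDimensional k (invariants (comp Φ ρ) (hyperspecialSubgroup
          (integralClosure (v.adicCompletionIntegers (maximalRealSubfield K)) (w.adicCompletion K))
          (J3 (algebraMap (v.adicCompletionIntegers (maximalRealSubfield K)) (w.adicCompletion K)
            (u₀ : v.adicCompletionIntegers (maximalRealSubfield K)))))) := by rw [hinv]; infer_instance
  have hne' : invariants (comp Φ ρ) (hyperspecialSubgroup
          (integralClosure (v.adicCompletionIntegers (maximalRealSubfield K)) (w.adicCompletion K))
          (J3 (algebraMap (v.adicCompletionIntegers (maximalRealSubfield K)) (w.adicCompletion K)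
            (u₀ : v.adicCompletionIntegers (maximalRealSubfield K))))) ≠ ⊥ := by rw [hinv]; exact hne
  have key := exists_param_nonempty_equiv_inertSphericalQuot_of_eq' (hstar_of_star_eq (localConj v w hθ.symm (span_pair_eq_top K hy) hsq (complexConj K)) hst)
    (algebraMap (v.adicCompletionIntegers (maximalRealSubfield K)) (w.adicCompletion K)
      (u₀ : v.adicCompletionIntegers (maximalRealSubfield K)))
    (star_algebraMap_of_star_eq (localConj v w hθ.symm (span_pair_eq_top K hy) hsq (complexConj K)) hst (u₀ : v.adicCompletionIntegers (maximalRealSubfield K)))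
    (algebraMap_unit_ne_zero (F := v.adicCompletion (maximalRealSubfield K)) u₀)
    (isInteger_algebraMap (u₀ : v.adicCompletionIntegers (maximalRealSubfield K)))
    (isInteger_algebraMap_unit_inv u₀)
    (irreducible_uniformiser (map_maximalIdeal_integralClosure_eq_of_irreducible v w hϖ hinert) hϖ)
    (star_algebraMap_of_star_eq (localConj v w hθ.symm (span_pair_eq_top K hy) hsq (complexConj K)) hst ϖ) k (exists_trace_lift_adicCompletion v w (localConj v w hθ.symm (span_pair_eq_top K hy) hsq (complexConj K)) hst he h2 hσ hϖ hinert)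
    (exists_residueStar_ne_adicCompletion v w (localConj v w hθ.symm (span_pair_eq_top K hy) hsq (complexConj K)) hst he h2 hσ hϖ hinert) (Ideal.absNorm v.asIdeal : k)
    (by rw [card_traceZero_eq_absNorm v w (localConj v w hθ.symm (span_pair_eq_top K hy) hsq (complexConj K)) hst he h2 hσ hϖ hinert]) (comp Φ ρ) hirr hK' hfd hne'
  exact key.elim fun α h => ⟨α, h.1, h.2.elim fun e => ⟨equivCompSymm Φ ρ e⟩⟩

end MatchedIsomorphism

include hθ hy hsq he hϖ hinert in
/-- **THE UNRAMIFIED SPECTRUM OF THE RECORD'S OWN PAIR**: at an inert good place (`θ = y²` with `c(y) ≠ y`, `θ` a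
non-square in `K⁺_v`, `e(w/v) = 1`, `ϖ` inert), for the datum's hermitian unimodular `3 × 3` Gram matrix `H`
good at `w`, there are `u₀ ∈ 𝒪_{K⁺_v}ˣ` and a group isomorphism `Φ : U(J₃(u₀)) ≃* U(1 ⊗ H)` matching the hyperspecial
subgroups (file 241's `u₀`, `P` with `Pᴴ H_w P = J₃(u₀)`; `Φ = recordNonSplitEquiv'⁻¹ ∘ conjMulEquiv P`) such that
EVERY irreducible `K_v`-finite representation `ρ` of `U(1 ⊗ H)` with non-zero finite-dimensional `K_v`-invariants is
isomorphic to `(inertSphericalQuot (α N(v)⁻²)) ∘ Φ⁻¹` for some `α ≠ 0` — the spherical subquotient of the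
unramified principal series `I(α N(v)⁻²)` of `U(J₃(u₀))`, read on the record's group. -/
theorem exists_mulEquiv_forall_nonempty_equiv_inertSphericalQuot_record
    (hl : Submodule.span (𝓞 (maximalRealSubfield K)) (Set.range l) = ⊤)
    {H : Matrix (Fin 3) (Fin 3) K} (hH : H.IsHermitian) (hdet : IsUnit H.det) (hgood : w ∉ badSet H) :
    letI := tensorStarRing K v
    letI := starRingOfQuadratic (finrank_eq_two K v w hθ hy hsq) (localConj v w hθ.symm (span_pair_eq_top K hy) hsq (complexConj K))
      (localConj_ne_one v w hθ.symm (span_pair_eq_top K hy) hsq (complexConj K)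
        (complexConj_apply_eq_neg K hθ hy))
    ∃ (u₀ : (v.adicCompletionIntegers (maximalRealSubfield K))ˣ)
      (Φ : ↥(formUnitaryGroup (J3 (algebraMap (v.adicCompletionIntegers (maximalRealSubfield K))
        (w.adicCompletion K) (u₀ : v.adicCompletionIntegers (maximalRealSubfield K))))) ≃*
        ↥(formUnitaryGroup (tensorGram K v H))),
      (∀ g, g ∈ hyperspecialSubgroup
          (integralClosure (v.adicCompletionIntegers (maximalRealSubfield K)) (w.adicCompletion K))
          (J3 (algebraMap (v.adicCompletionIntegers (maximalRealSubfield K)) (w.adicCompletion K)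
            (u₀ : v.adicCompletionIntegers (maximalRealSubfield K)))) ↔ Φ g ∈ recordHyperspecial K v l H) ∧
      ∀ {V : Type*} [AddCommGroup V] [Module k V]
        (ρ : Representation k (↥(formUnitaryGroup (tensorGram K v H))) V) [ρ.IsIrreducible],
        KFinite ρ (recordHyperspecial K v l H) →
        ∀ [FiniteDimensional k (invariants ρ (recordHyperspecial K v l H))],
        invariants ρ (recordHyperspecial K v l H) ≠ ⊥ →
        ∃ α : k, α ≠ 0 ∧ Nonempty (ρ.Equiv (comp Φ.symm
          (inertSphericalQuot (hstar_of_star_eq (localConj v w hθ.symm (span_pair_eq_top K hy) hsq (complexConj K)) (fun x => by rw [star_p8_eq_star K v w hθ hy hsq]; rfl))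
            (algebraMap (v.adicCompletionIntegers (maximalRealSubfield K)) (w.adicCompletion K)
              (u₀ : v.adicCompletionIntegers (maximalRealSubfield K)))
            (star_algebraMap_of_star_eq (localConj v w hθ.symm (span_pair_eq_top K hy) hsq (complexConj K)) (fun x => by rw [star_p8_eq_star K v w hθ hy hsq]; rfl) (u₀ : v.adicCompletionIntegers (maximalRealSubfield K)))
            (algebraMap_unit_ne_zero (F := v.adicCompletion (maximalRealSubfield K)) u₀)
            (isInteger_algebraMap (u₀ : v.adicCompletionIntegers (maximalRealSubfield K)))
            (isInteger_algebraMap_unit_inv u₀)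
            (irreducible_uniformiser (map_maximalIdeal_integralClosure_eq_of_irreducible v w hϖ hinert) hϖ)
            (star_algebraMap_of_star_eq (localConj v w hθ.symm (span_pair_eq_top K hy) hsq (complexConj K)) (fun x => by rw [star_p8_eq_star K v w hθ hy hsq]; rfl) ϖ) k
            (α * ((Ideal.absNorm v.asIdeal : k) ^ 2)⁻¹)))) := by
  letI := tensorStarRing K v
  letI := starRingOfQuadratic (finrank_eq_two K v w hθ hy hsq) (localConj v w hθ.symm (span_pair_eq_top K hy) hsq (complexConj K))
    (localConj_ne_one v w hθ.symm (span_pair_eq_top K hy) hsq (complexConj K)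
      (complexConj_apply_eq_neg K hθ hy))
  refine (exists_cell_doubleCosetOp_aeval_bijective_record K v w hθ hy hsq hϖ hinert l k hl hH hdet hgood).elim
    fun u₀ h1 => h1.elim fun P h2 => h2.elim fun g₀ h3 => ?_
  have hPr := h3.1
  have hP := h3.2.1
  -- the two spellings of `K_{H_w}`
  have hKw : hyperspecialSubgroup (integralClosure (v.adicCompletionIntegers (maximalRealSubfield K))
      (w.adicCompletion K)) (H.map (algebraMap K (w.adicCompletion K))) =
      hyperspecialSubgroup (w.adicCompletionIntegers K) (H.map (algebraMap K (w.adicCompletion K))) :=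
    hyperspecialSubgroup_integralClosure_eq (R := v.adicCompletionIntegers (maximalRealSubfield K))
      (A := w.adicCompletionIntegers K) _
  have hmatch : ∀ g, g ∈ hyperspecialSubgroup
          (integralClosure (v.adicCompletionIntegers (maximalRealSubfield K)) (w.adicCompletion K))
          (J3 (algebraMap (v.adicCompletionIntegers (maximalRealSubfield K)) (w.adicCompletion K)
            (u₀ : v.adicCompletionIntegers (maximalRealSubfield K)))) ↔
      ((conjMulEquiv P hP).trans (recordNonSplitEquiv' K v w hθ hy hsq H).symm) g ∈
        recordHyperspecial K v l H := by
    intro g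
    rw [MulEquiv.trans_apply, mem_recordHyperspecial_iff_nonSplit K v w hθ hy hsq l hl H,
      MulEquiv.apply_symm_apply, ← hKw, ← mem_hyperspecialSubgroup_conjMulEquiv_iff P hP hPr g]
  have hst : ∀ x : w.adicCompletion K, star x = (localConj v w hθ.symm (span_pair_eq_top K hy) hsq (complexConj K)) x := fun x => by
    rw [star_p8_eq_star K v w hθ hy hsq]
    rfl
  exact ⟨u₀, (conjMulEquiv P hP).trans (recordNonSplitEquiv' K v w hθ hy hsq H).symm, hmatch,
    fun ρ _ hK _ hne =>
      forall_nonempty_equiv_inertSphericalQuot_record_of_mulEquiv K v w hθ hy hsq he hϖ hinert l k hst u₀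
        ((conjMulEquiv P hP).trans (recordNonSplitEquiv' K v w hθ hy hsq H).symm) hmatch ρ hK hne⟩

end Record

end Summit.Ventures.HodgeRepro2.T5RecordSphericalSpectrum
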